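import Summits.QuantumFields.YangMills.Theorems.BalabanUVNodesN15CovariantLaplacianSpecies
import HarnessLib

/-!
# THE ROW LETTERS OF THE EXACT COEFFICIENTS `(v1coefCX, v1coefAX)` OF BAŁABAN's `V′₁(A)` (3.52) — V1a's twin with the backward `F′`-argument NEGATED as (3.50) demands
# (`F′_{−η}(ad A⁻) = F′_η(−ad A⁻)`): sups and fits (dag-n15-c g10, FILE 29a; Track-A node N15 = NE2, s1 «background-layer OPERATOR ingredient»)

`--kind proof --supports stmt-QuantumFields-20544 --as helper` (K3⁷; count-neutral; theorems only).  Imports BY NAME this seat's FILE 28 `…CovariantLaplacianSpecies` (`v1coefCX`, `v1coefAX`,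
`v1coefAX_inl` ∕ `_inr`, `Phi2_neg`; through it FILE 25 `…BackgroundV1TwoSidedLetters` (`fgradMat_entry`, `coordMat_smul`, `smul_coordMat_ad_sub`, `row_fgrad_ad_le`, `row_fgrad_Phi2ad_le`,
`row_dfit_ad_le`, `row_dfit_Phi2ad_le`), FILE 24 (`TwoSidedLetters`), g2 V1a∕V1b (`rowSum_Phi2ad_le`, `rowFit_ad_le`, `rowFit_Phi2ad_le`, `rowSum_smulPhi2ad_le`, `rowFit_smulPhi2ad_le`,
`rowSum_add_le`, `rowSum_sub_le`, `rowSum_sum_le`, `v1fieldsOfGauge`), n15-b parts 13a∕16∕17 (`coordMat`, `basisConst`, `rowBound_ad`), [Lit] `adCLM`); nothing in the tree is modified.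

WHAT.  `adCLM_neg` and the six NEGATED-LETTER mechanisms `rowSum_Phi2negad_le`, `rowFit_Phi2negad_le`, `rowSum_smulPhi2negad_le`, `rowFit_smulPhi2negad_le`, `row_fgrad_Phi2negad_le`,
`row_dfit_Phi2negad_le` (the V1a ∕ FILE 25 letters of `F′_η(ad ·)` transported to `F′_{−η}(ad ·) = F′_η(ad(−·))`: a field and its negative have the same sups, fits and one-step letters);
the four coefficient letters `rowSum_v1coefCX_le`, `rowSum_v1coefAX_le`, `rowFit_v1coefCX`, `rowFit_v1coefAX` (V1a's statements and constants for the exact coefficients).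

WHY.  FILE 28 proved that `(v1coefCX, v1coefAX)` are the coefficients of the EXACT identity (3.53) `Δ_{e^{ηA}} = Δ − V′₁(A)`; FILE 29b assembles the fifteen `TwoSidedLetters` from these,
FILE 30 knits `NE2PlusOperator` BY NAME for the exactly dressed operator family, FILE 31 identifies that family's propagator with the Green's function of Bałaban's `Δ_a` with its
Laplacian made covariant.

HONEST FRAMING.  Crude constants; `U ≡ 1` chart; `𝔤 ↦ 𝔄` with coordinates `e`; nothing about `G(U)` asserted here; NE2⁺ NOT PRINTED; count-neutral; N15 NOT discharged; one finite torus
at fixed ε — NOT ℝ⁴, NOT infinite volume, NOT OS, NOT a mass gap, NOT Clay.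
-/

noncomputable section

open scoped BigOperators
open Finset

namespace Summit.QuantumFields.YangMills.BalabanUVNodes.N15.BackgroundLayer

open Literature.MathematicalPhysics.QuantumFieldTheory.Balaban1983to89.Beta.AveragingCorrectionJets (adCLM adL adCLM_smul adCLM_eq_adL)
open Summit.QuantumFields.YangMills.BalabanUVNodes.N15.MatrixSpecies (Phi2 coordMat coordMat_sub basisConst basisConst_nonneg rowDiff_ad adCLM_sub rowBound_ad)

/-! ## §1 The negated-letter mechanisms and the four coefficient letters -/

section Mechanisms

variable {X X' J ι : Type} [Fintype ι] [DecidableEq ι] {𝔄 : Type} [NormedRing 𝔄] [NormedAlgebra ℝ 𝔄] [CompleteSpace 𝔄] (e : 𝔄 ≃L[ℝ] (ι → ℝ))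

omit [Fintype ι] [DecidableEq ι] [CompleteSpace 𝔄] in
/-- `ad(−a) = −ad(a)`. [folklore] -/
theorem adCLM_neg (a : 𝔄) : adCLM ℝ (-a) = -adCLM ℝ a := by
  rw [adCLM_eq_adL, adCLM_eq_adL, map_neg]

/-- ROW LETTER of `F′_{−s}(ad Z) = F′_s(ad(−Z))`: `≤ κ_e·2e·r` (V1a `rowSum_Phi2ad_le` for the negated field). [folklore] -/
theorem rowSum_Phi2negad_le {r s : ℝ} (hr : 0 ≤ r) (hr2 : 2 * r ≤ 1) (hs0 : 0 ≤ s) (hs : s ≤ 1) {a : X → 𝔄} (ha : ∀ x, ‖a x‖ ≤ r) (x : X) (i : ι) :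
    ∑ j, |coordMat e (Phi2 (-s) (adCLM ℝ (a x))) i j| ≤ basisConst e * (2 * Real.exp 1 * r) := by
  rw [Phi2_neg, ← adCLM_neg]
  exact rowSum_Phi2ad_le e hr hr2 hs0 hs (a := fun x => -a x) (fun x => by rw [norm_neg]; exact ha x) x i

/-- ROW FIT of `F′_{−η}(ad ·)`: `≤ κ_e·6e·rθ` (V1a `rowFit_Phi2ad_le` for the negated fields). [folklore] -/
theorem rowFit_Phi2negad_le (π : X' → X) {r η η' θ : ℝ} (hr : 0 ≤ r) (hr2 : 2 * r ≤ 1) (hη' : 0 ≤ η') (hη'η : η' ≤ η) (hη1 : η ≤ 1) (hηθ : η ≤ θ)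
    {a' : X' → 𝔄} {a : X → 𝔄} (ha' : ∀ x', ‖a' x'‖ ≤ r) (ha : ∀ x, ‖a x‖ ≤ r) (hfit : ∀ x', ‖a' x' - a (π x')‖ ≤ r * θ) (x' : X') (i : ι) :
    ∑ j, |coordMat e (Phi2 (-η') (adCLM ℝ (a' x'))) i j - coordMat e (Phi2 (-η) (adCLM ℝ (a (π x')))) i j| ≤ basisConst e * (6 * Real.exp 1 * (r * θ)) := by
  rw [Phi2_neg, Phi2_neg, ← adCLM_neg, ← adCLM_neg]
  exact rowFit_Phi2ad_le e π hr hr2 hη' hη'η hη1 hηθ (a' := fun x' => -a' x') (a := fun x => -a x) (fun x' => by rw [norm_neg]; exact ha' x')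
    (fun x => by rw [norm_neg]; exact ha x) (fun x' => by rw [neg_sub_neg, norm_sub_rev]; exact hfit x') x' i

/-- ROW LETTER of `η·F′_{−η}(ad Z)`: `≤ κ_e·2e·r`. [folklore] -/
theorem rowSum_smulPhi2negad_le {r η : ℝ} (hr : 0 ≤ r) (hr2 : 2 * r ≤ 1) (hη0 : 0 ≤ η) (hη1 : η ≤ 1) {a : X → 𝔄} (ha : ∀ x, ‖a x‖ ≤ r) (x : X) (i : ι) :
    ∑ j, |(η • coordMat e (Phi2 (-η) (adCLM ℝ (a x)))) i j| ≤ basisConst e * (2 * Real.exp 1 * r) := by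
  rw [Phi2_neg, ← adCLM_neg]
  exact rowSum_smulPhi2ad_le e hr hr2 hη0 hη1 (a := fun x => -a x) (fun x => by rw [norm_neg]; exact ha x) x i

/-- ROW FIT of `η·F′_{−η}(ad ·)`: `≤ κ_e·8e·rθ`. [folklore] -/
theorem rowFit_smulPhi2negad_le (π : X' → X) {r η η' θ : ℝ} (hr : 0 ≤ r) (hr2 : 2 * r ≤ 1) (hη' : 0 ≤ η') (hη'η : η' ≤ η) (hη1 : η ≤ 1) (hηθ : η ≤ θ)
    {a' : X' → 𝔄} {a : X → 𝔄} (ha' : ∀ x', ‖a' x'‖ ≤ r) (ha : ∀ x, ‖a x‖ ≤ r) (hfit : ∀ x', ‖a' x' - a (π x')‖ ≤ r * θ) (x' : X') (i : ι) :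
    ∑ j, |(η' • coordMat e (Phi2 (-η') (adCLM ℝ (a' x')))) i j - (η • coordMat e (Phi2 (-η) (adCLM ℝ (a (π x'))))) i j| ≤
      basisConst e * (8 * Real.exp 1 * (r * θ)) := by
  rw [Phi2_neg, Phi2_neg, ← adCLM_neg, ← adCLM_neg]
  exact rowFit_smulPhi2ad_le e π hr hr2 hη' hη'η hη1 hηθ (a' := fun x' => -a' x') (a := fun x => -a x) (fun x' => by rw [norm_neg]; exact ha' x')
    (fun x => by rw [norm_neg]; exact ha x) (fun x' => by rw [neg_sub_neg, norm_sub_rev]; exact hfit x') x' i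

/-- GRADIENT ROW of the `F′_{−η}`-part: `≤ κ_e·6e·rη` (FILE 25 `row_fgrad_Phi2ad_le` for the negated field). [folklore] -/
theorem row_fgrad_Phi2negad_le {η r : ℝ} (hη : 0 < η) (hη1 : η ≤ 1) (hr : 0 ≤ r) (hr2 : 2 * r ≤ 1) (τ : X ≃ X) {a : X → 𝔄} (ha : ∀ x, ‖a x‖ ≤ r)
    (hδ : ∀ x, ‖a x - a (τ.symm x)‖ ≤ r * η) (x : X) (i : ι) :
    ∑ j, |η⁻¹ * (η * coordMat e (Phi2 (-η) (adCLM ℝ (a (τ x)))) i j - η * coordMat e (Phi2 (-η) (adCLM ℝ (a x))) i j)| ≤ basisConst e * (6 * Real.exp 1 * (r * η)) := by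
  simp only [Phi2_neg, ← adCLM_neg]
  exact row_fgrad_Phi2ad_le e hη hη1 hr hr2 τ (a := fun x => -a x) (fun x => by rw [norm_neg]; exact ha x)
    (fun x => by rw [neg_sub_neg, norm_sub_rev]; exact hδ x) x i

/-- DERIVATIVE FIT of the `F′_{−η}`-part: `≤ κ_e·12e·rθ` (FILE 25 `row_dfit_Phi2ad_le` for the negated fields). [folklore] -/
theorem row_dfit_Phi2negad_le (π : X' → X) {r η η' θ : ℝ} (hr : 0 ≤ r) (hr2 : 2 * r ≤ 1) (hη' : 0 ≤ η') (hη'η : η' ≤ η) (hη1 : η ≤ 1) (hηθ : η ≤ θ)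
    {a' b' : X' → 𝔄} {a b : X → 𝔄} (ha' : ∀ x', ‖a' x'‖ ≤ r) (hb' : ∀ x', ‖b' x'‖ ≤ r) (ha : ∀ x, ‖a x‖ ≤ r) (hb : ∀ x, ‖b x‖ ≤ r)
    (hfa : ∀ x', ‖a' x' - a (π x')‖ ≤ r * θ) (hfb : ∀ x', ‖b' x' - b (π x')‖ ≤ r * θ) (x' : X') (i : ι) :
    ∑ j, |(coordMat e (Phi2 (-η') (adCLM ℝ (a' x'))) i j - coordMat e (Phi2 (-η') (adCLM ℝ (b' x'))) i j) -
        (coordMat e (Phi2 (-η) (adCLM ℝ (a (π x')))) i j - coordMat e (Phi2 (-η) (adCLM ℝ (b (π x')))) i j)| ≤ basisConst e * (12 * Real.exp 1 * (r * θ)) := by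
  simp only [Phi2_neg, ← adCLM_neg]
  exact row_dfit_Phi2ad_le e π hr hr2 hη' hη'η hη1 hηθ (a' := fun x' => -a' x') (b' := fun x' => -b' x') (a := fun x => -a x) (b := fun x => -b x)
    (fun x' => by rw [norm_neg]; exact ha' x') (fun x' => by rw [norm_neg]; exact hb' x') (fun x => by rw [norm_neg]; exact ha x) (fun x => by rw [norm_neg]; exact hb x)
    (fun x' => by rw [neg_sub_neg, norm_sub_rev]; exact hfa x') (fun x' => by rw [neg_sub_neg, norm_sub_rev]; exact hfb x') x' i

variable [Fintype J]

/-- ROW LETTER of `c`: `≤ κ_e(2r + |J|·4e·r) ≤ 4e(1+|J|)κ_e·r` on fields of size `≤ r`, `2r ≤ 1`, `0 ≤ η ≤ 1`. [folklore] -/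
theorem rowSum_v1coefCX_le {r η : ℝ} (hr : 0 ≤ r) (hr2 : 2 * r ≤ 1) (hη0 : 0 ≤ η) (hη1 : η ≤ 1) {U : (J → X → 𝔄) × (J → X → 𝔄) × (X → 𝔄)}
    (hU₁ : ∀ μ x, ‖U.1 μ x‖ ≤ r) (hU₂ : ∀ μ x, ‖U.2.1 μ x‖ ≤ r) (hU₃ : ∀ x, ‖U.2.2 x‖ ≤ r) (x : X) (i : ι) :
    ∑ j, |v1coefCX e η U x i j| ≤ 4 * Real.exp 1 * (1 + Fintype.card J) * basisConst e * r := by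
  unfold v1coefCX
  have hκ := basisConst_nonneg e
  have he : (1 : ℝ) ≤ Real.exp 1 := by have := Real.add_one_le_exp (1 : ℝ); linarith
  have hW := rowBound_ad e hU₃ x i
  have hsum : ∑ j, |(∑ μ, (coordMat e (Phi2 η (adCLM ℝ (U.1 μ x))) + coordMat e (Phi2 (-η) (adCLM ℝ (U.2.1 μ x))))) i j| ≤
      Fintype.card J * (2 * (basisConst e * (2 * Real.exp 1 * r))) := by
    refine (rowSum_sum_le _ i).trans ?_
    calc ∑ μ, ∑ j, |(coordMat e (Phi2 η (adCLM ℝ (U.1 μ x))) + coordMat e (Phi2 (-η) (adCLM ℝ (U.2.1 μ x)))) i j|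
        ≤ ∑ _μ : J, 2 * (basisConst e * (2 * Real.exp 1 * r)) := Finset.sum_le_sum fun μ _ =>
          (rowSum_add_le _ _ i).trans (by
            have h1 := rowSum_Phi2ad_le e hr hr2 hη0 hη1 (hU₁ μ) x i
            have h2 := rowSum_Phi2negad_le e hr hr2 hη0 hη1 (hU₂ μ) x i
            linarith)
      _ = Fintype.card J * (2 * (basisConst e * (2 * Real.exp 1 * r))) := by rw [Finset.sum_const, Finset.card_univ, nsmul_eq_mul]
  refine (rowSum_add_le _ _ i).trans ?_
  have hJ : (0 : ℝ) ≤ Fintype.card J := Nat.cast_nonneg _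
  nlinarith [hW, hsum, mul_nonneg hκ hr, mul_nonneg (mul_nonneg hJ hκ) hr]

omit [Fintype J] in
/-- ROW LETTER of `a^±_μ`: `≤ κ_e(2r + 2e·r) ≤ 4e·κ_e·r`. [folklore] -/
theorem rowSum_v1coefAX_le {r η : ℝ} (hr : 0 ≤ r) (hr2 : 2 * r ≤ 1) (hη0 : 0 ≤ η) (hη1 : η ≤ 1) {U : (J → X → 𝔄) × (J → X → 𝔄) × (X → 𝔄)}
    (hU₁ : ∀ μ x, ‖U.1 μ x‖ ≤ r) (hU₂ : ∀ μ x, ‖U.2.1 μ x‖ ≤ r) (jμ : J ⊕ J) (x : X) (i : ι) :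
    ∑ j, |v1coefAX e η U jμ x i j| ≤ 4 * Real.exp 1 * basisConst e * r := by
  have hκ := basisConst_nonneg e
  have he : (1 : ℝ) ≤ Real.exp 1 := by have := Real.add_one_le_exp (1 : ℝ); linarith
  rcases jμ with μ | μ
  · show ∑ j, |(coordMat e (adCLM ℝ (U.1 μ x)) + η • coordMat e (Phi2 η (adCLM ℝ (U.1 μ x)))) i j| ≤ _
    have h1 := rowBound_ad e (hU₁ μ) x i
    have h2 := rowSum_smulPhi2ad_le e hr hr2 hη0 hη1 (hU₁ μ) x i
    refine (rowSum_add_le _ _ i).trans ?_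
    nlinarith [mul_nonneg hκ hr]
  · show ∑ j, |(coordMat e (adCLM ℝ (U.2.1 μ x)) - η • coordMat e (Phi2 (-η) (adCLM ℝ (U.2.1 μ x)))) i j| ≤ _
    have h1 := rowBound_ad e (hU₂ μ) x i
    have h2 := rowSum_smulPhi2negad_le e hr hr2 hη0 hη1 (hU₂ μ) x i
    refine (rowSum_sub_le _ _ i).trans ?_
    nlinarith [mul_nonneg hκ hr]

variable (π : X' → X) {r η η' θ : ℝ} {U' : (J → X' → 𝔄) × (J → X' → 𝔄) × (X' → 𝔄)} {U : (J → X → 𝔄) × (J → X → 𝔄) × (X → 𝔄)}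

/-- ROW FIT of `c`: `≤ κ_e(2 + 12e|J|)·rθ ≤ 12e(1+|J|)κ_e·rθ` from the three field fits `rθ`. [folklore] -/
theorem rowFit_v1coefCX (hr : 0 ≤ r) (hr2 : 2 * r ≤ 1) (hη' : 0 ≤ η') (hη'η : η' ≤ η) (hη1 : η ≤ 1) (hηθ : η ≤ θ)
    (hU'₁ : ∀ μ x', ‖U'.1 μ x'‖ ≤ r) (hU'₂ : ∀ μ x', ‖U'.2.1 μ x'‖ ≤ r) (hU₁ : ∀ μ x, ‖U.1 μ x‖ ≤ r) (hU₂ : ∀ μ x, ‖U.2.1 μ x‖ ≤ r)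
    (hf₁ : ∀ μ x', ‖U'.1 μ x' - U.1 μ (π x')‖ ≤ r * θ) (hf₂ : ∀ μ x', ‖U'.2.1 μ x' - U.2.1 μ (π x')‖ ≤ r * θ)
    (hf₃ : ∀ x', ‖U'.2.2 x' - U.2.2 (π x')‖ ≤ r * θ) (x' : X') (i : ι) :
    ∑ j, |v1coefCX e η' U' x' i j - v1coefCX e η U (π x') i j| ≤ 12 * Real.exp 1 * (1 + Fintype.card J) * basisConst e * (r * θ) := by
  have hκ := basisConst_nonneg e
  have he : (1 : ℝ) ≤ Real.exp 1 := by have := Real.add_one_le_exp (1 : ℝ); linarith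
  have hθ0 : 0 ≤ θ := (hη'.trans hη'η).trans hηθ
  have hrθ : 0 ≤ r * θ := mul_nonneg hr hθ0
  have hsplit : v1coefCX e η' U' x' - v1coefCX e η U (π x') =
      (coordMat e (adCLM ℝ (U'.2.2 x')) - coordMat e (adCLM ℝ (U.2.2 (π x')))) +
        ∑ μ, ((coordMat e (Phi2 η' (adCLM ℝ (U'.1 μ x'))) - coordMat e (Phi2 η (adCLM ℝ (U.1 μ (π x'))))) +
          (coordMat e (Phi2 (-η') (adCLM ℝ (U'.2.1 μ x'))) - coordMat e (Phi2 (-η) (adCLM ℝ (U.2.1 μ (π x')))))) := by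
    unfold v1coefCX
    simp only [Finset.sum_add_distrib, Finset.sum_sub_distrib]
    abel
  have hW : ∑ j, |(coordMat e (adCLM ℝ (U'.2.2 x')) - coordMat e (adCLM ℝ (U.2.2 (π x')))) i j| ≤ basisConst e * (2 * (r * θ)) := by
    simpa only [Matrix.sub_apply] using rowFit_ad_le e π hf₃ x' i
  have hsum : ∑ j, |(∑ μ, ((coordMat e (Phi2 η' (adCLM ℝ (U'.1 μ x'))) - coordMat e (Phi2 η (adCLM ℝ (U.1 μ (π x'))))) +
        (coordMat e (Phi2 (-η') (adCLM ℝ (U'.2.1 μ x'))) - coordMat e (Phi2 (-η) (adCLM ℝ (U.2.1 μ (π x'))))))) i j| ≤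
      Fintype.card J * (2 * (basisConst e * (6 * Real.exp 1 * (r * θ)))) := by
    refine (rowSum_sum_le _ i).trans ?_
    calc _ ≤ ∑ _μ : J, 2 * (basisConst e * (6 * Real.exp 1 * (r * θ))) := Finset.sum_le_sum fun μ _ =>
          (rowSum_add_le _ _ i).trans (by
            have h1 : ∑ j, |(coordMat e (Phi2 η' (adCLM ℝ (U'.1 μ x'))) - coordMat e (Phi2 η (adCLM ℝ (U.1 μ (π x'))))) i j| ≤
                basisConst e * (6 * Real.exp 1 * (r * θ)) := by
              simpa only [Matrix.sub_apply] using rowFit_Phi2ad_le e π hr hr2 hη' hη'η hη1 hηθ (hU'₁ μ) (hU₁ μ) (hf₁ μ) x' i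
            have h2 : ∑ j, |(coordMat e (Phi2 (-η') (adCLM ℝ (U'.2.1 μ x'))) - coordMat e (Phi2 (-η) (adCLM ℝ (U.2.1 μ (π x'))))) i j| ≤
                basisConst e * (6 * Real.exp 1 * (r * θ)) := by
              simpa only [Matrix.sub_apply] using rowFit_Phi2negad_le e π hr hr2 hη' hη'η hη1 hηθ (hU'₂ μ) (hU₂ μ) (hf₂ μ) x' i
            linarith)
      _ = Fintype.card J * (2 * (basisConst e * (6 * Real.exp 1 * (r * θ)))) := by rw [Finset.sum_const, Finset.card_univ, nsmul_eq_mul]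
  have hJ : (0 : ℝ) ≤ Fintype.card J := Nat.cast_nonneg _
  calc ∑ j, |v1coefCX e η' U' x' i j - v1coefCX e η U (π x') i j| = ∑ j, |(v1coefCX e η' U' x' - v1coefCX e η U (π x')) i j| := by
        simp only [Matrix.sub_apply]
    _ ≤ _ := by
        rw [hsplit]
        refine (rowSum_add_le _ _ i).trans ?_
        nlinarith [hW, hsum, mul_nonneg hκ hrθ, mul_nonneg (mul_nonneg hJ hκ) hrθ]

omit [Fintype J] in
/-- ROW FIT of `a^±_μ`: `≤ κ_e(2 + 8e)·rθ ≤ 10e·κ_e·rθ`. [folklore] -/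
theorem rowFit_v1coefAX (hr : 0 ≤ r) (hr2 : 2 * r ≤ 1) (hη' : 0 ≤ η') (hη'η : η' ≤ η) (hη1 : η ≤ 1) (hηθ : η ≤ θ)
    (hU'₁ : ∀ μ x', ‖U'.1 μ x'‖ ≤ r) (hU'₂ : ∀ μ x', ‖U'.2.1 μ x'‖ ≤ r) (hU₁ : ∀ μ x, ‖U.1 μ x‖ ≤ r) (hU₂ : ∀ μ x, ‖U.2.1 μ x‖ ≤ r)
    (hf₁ : ∀ μ x', ‖U'.1 μ x' - U.1 μ (π x')‖ ≤ r * θ) (hf₂ : ∀ μ x', ‖U'.2.1 μ x' - U.2.1 μ (π x')‖ ≤ r * θ) (jμ : J ⊕ J) (x' : X') (i : ι) :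
    ∑ j, |v1coefAX e η' U' jμ x' i j - v1coefAX e η U jμ (π x') i j| ≤ 10 * Real.exp 1 * basisConst e * (r * θ) := by
  have hκ := basisConst_nonneg e
  have he : (1 : ℝ) ≤ Real.exp 1 := by have := Real.add_one_le_exp (1 : ℝ); linarith
  have hθ0 : 0 ≤ θ := (hη'.trans hη'η).trans hηθ
  have hrθ : 0 ≤ r * θ := mul_nonneg hr hθ0
  rcases jμ with μ | μ
  · have hsplit : v1coefAX e η' U' (Sum.inl μ) x' - v1coefAX e η U (Sum.inl μ) (π x') =
        (coordMat e (adCLM ℝ (U'.1 μ x')) - coordMat e (adCLM ℝ (U.1 μ (π x')))) +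
          (η' • coordMat e (Phi2 η' (adCLM ℝ (U'.1 μ x'))) - η • coordMat e (Phi2 η (adCLM ℝ (U.1 μ (π x'))))) := by
      show (coordMat e (adCLM ℝ (U'.1 μ x')) + η' • coordMat e (Phi2 η' (adCLM ℝ (U'.1 μ x')))) -
          (coordMat e (adCLM ℝ (U.1 μ (π x'))) + η • coordMat e (Phi2 η (adCLM ℝ (U.1 μ (π x'))))) = _
      abel
    have h1 : ∑ j, |(coordMat e (adCLM ℝ (U'.1 μ x')) - coordMat e (adCLM ℝ (U.1 μ (π x')))) i j| ≤ basisConst e * (2 * (r * θ)) := by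
      simpa only [Matrix.sub_apply] using rowFit_ad_le e π (hf₁ μ) x' i
    have h2 : ∑ j, |(η' • coordMat e (Phi2 η' (adCLM ℝ (U'.1 μ x'))) - η • coordMat e (Phi2 η (adCLM ℝ (U.1 μ (π x'))))) i j| ≤
        basisConst e * (8 * Real.exp 1 * (r * θ)) := by
      simpa only [Matrix.sub_apply] using rowFit_smulPhi2ad_le e π hr hr2 hη' hη'η hη1 hηθ (hU'₁ μ) (hU₁ μ) (hf₁ μ) x' i
    calc ∑ j, |v1coefAX e η' U' (Sum.inl μ) x' i j - v1coefAX e η U (Sum.inl μ) (π x') i j|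
        = ∑ j, |(v1coefAX e η' U' (Sum.inl μ) x' - v1coefAX e η U (Sum.inl μ) (π x')) i j| := by simp only [Matrix.sub_apply]
      _ ≤ _ := by
          rw [hsplit]
          refine (rowSum_add_le _ _ i).trans ?_
          nlinarith [h1, h2, mul_nonneg hκ hrθ]
  · have hsplit : v1coefAX e η' U' (Sum.inr μ) x' - v1coefAX e η U (Sum.inr μ) (π x') =
        (coordMat e (adCLM ℝ (U'.2.1 μ x')) - coordMat e (adCLM ℝ (U.2.1 μ (π x')))) -
          (η' • coordMat e (Phi2 (-η') (adCLM ℝ (U'.2.1 μ x'))) - η • coordMat e (Phi2 (-η) (adCLM ℝ (U.2.1 μ (π x'))))) := by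
      show (coordMat e (adCLM ℝ (U'.2.1 μ x')) - η' • coordMat e (Phi2 (-η') (adCLM ℝ (U'.2.1 μ x')))) -
          (coordMat e (adCLM ℝ (U.2.1 μ (π x'))) - η • coordMat e (Phi2 (-η) (adCLM ℝ (U.2.1 μ (π x'))))) = _
      abel
    have h1 : ∑ j, |(coordMat e (adCLM ℝ (U'.2.1 μ x')) - coordMat e (adCLM ℝ (U.2.1 μ (π x')))) i j| ≤ basisConst e * (2 * (r * θ)) := by
      simpa only [Matrix.sub_apply] using rowFit_ad_le e π (hf₂ μ) x' i
    have h2 : ∑ j, |(η' • coordMat e (Phi2 (-η') (adCLM ℝ (U'.2.1 μ x'))) - η • coordMat e (Phi2 (-η) (adCLM ℝ (U.2.1 μ (π x'))))) i j| ≤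
        basisConst e * (8 * Real.exp 1 * (r * θ)) := by
      simpa only [Matrix.sub_apply] using rowFit_smulPhi2negad_le e π hr hr2 hη' hη'η hη1 hηθ (hU'₂ μ) (hU₂ μ) (hf₂ μ) x' i
    calc ∑ j, |v1coefAX e η' U' (Sum.inr μ) x' i j - v1coefAX e η U (Sum.inr μ) (π x') i j|
        = ∑ j, |(v1coefAX e η' U' (Sum.inr μ) x' - v1coefAX e η U (Sum.inr μ) (π x')) i j| := by simp only [Matrix.sub_apply]
      _ ≤ _ := by
          rw [hsplit]
          refine (rowSum_sub_le _ _ i).trans ?_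
          nlinarith [h1, h2, mul_nonneg hκ hrθ]


end Mechanisms

end Summit.QuantumFields.YangMills.BalabanUVNodes.N15.BackgroundLayer

end
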